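import Literature.Analysis.FluidPDE.StatisticalSolutionEnergyEq
import HarnessLib

/-!
# Stub `stub_starvedRide` of line `sweep-test-cyclic-tlf-witness`
# (crux `TaylorCertificates.EnsembleCeiling`, stmt-AnomalousDissipation-14090)

STARVED STATES RIDE ON FED ONES, SHELL BY SHELL — the energetic half of the line, valid for every
smooth force `f` on `T³`.  Call a state `u ∈ H` FED at viscosity `ν` when it has finite enstrophy
and dissipates no more than the force injects, `ν‖∇u‖² ≤ (u, f)`.  For `ν > 0`, a stationary
statistical solution `μ` of `NS_ν(f)` (Foias–Manley–Rosa–Temam, Ch. IV Def. 1.3: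
`Torus.IsStationaryStatisticalSolution ν f μ`) and `a > 0`: if `μ` charges no fed state of the
half-infinite energy shell `{a ≤ |u|}`, then it charges no state of that shell at all.

**Proof.**  The shell energy inequality (1.31) (`energy_ineq`) with `e₁ = (ENNReal.ofReal a)²`,
`e₂ = ⊤` reads `∫_{a ≤ |u|} I dμ ≤ 0` for the integrable integrand `I(u) = ν‖∇u‖² − (u, f)`
(`integrable_toReal_eGradNormSq`, `integrable_pairing`; the `ENNReal` shell
`{e₁ ≤ ‖u‖ₑ² < ⊤}` is `{a ≤ |u|}` for `a > 0`, exactly as in the tree's proof of the support bound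
`IsStationaryStatisticalSolution.ae_norm_le`, from which the shell identification is adapted).
On the other hand `μ`-a.e. state has finite enstrophy (`ae_eGradNormSq_lt_top`, (1.29)) and by
hypothesis `μ`-a.e. state of the shell is not fed, hence STARVED: `(u, f) < ν‖∇u‖²`, i.e. `I > 0`
`μ`-a.e. on the shell.  So `∫_{a ≤ |u|} I dμ = 0` with `I ≥ 0` a.e. on the shell, whence `I = 0`
a.e. on the shell (`integral_eq_zero_iff_of_nonneg_ae`), contradicting `I > 0` unless the shell is
`μ`-null.  No Liouville equation (1.30) is used.

References: C. Foias, O. Manley, R. Rosa, R. Temam, *Navier–Stokes Equations and Turbulence*,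
Cambridge Univ. Press (2001), Ch. IV §1.2, Def. 1.3, (1.29)–(1.31), (1.34), pp. 196–198.
-/

-- `Summit.<Summit>.<Problem>` is the tree's mandated summit-side namespace (CONVENTIONS §2); for this
-- single-conjunct summit the two coincide, so the duplicate is deliberate.
set_option linter.dupNamespace false

noncomputable section

namespace Summit.AnomalousDissipation.AnomalousDissipation.Theorems.TaylorCertificatesEnsembleCeiling

open MeasureTheory UnitAddTorus
open scoped InnerProductSpace ENNReal
open Literature.Analysis.FunctionSpaces Literature.Analysis.FluidPDE

/-- Local notation: real vector fields on `T³`. -/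
local notation "Vec3" => ((UnitAddTorus (Fin 3)) → (EuclideanSpace ℝ (Fin 3)))
/-- Local notation: `L²(T³; ℝ³)`. -/
local notation "L2" => (Lp (EuclideanSpace ℝ (Fin 3)) 2 (volume : Measure (UnitAddTorus (Fin 3))))
/-- Local notation: the energy space `H`. -/
local notation "H3" => (Torus.energySpace (Fin 3))
/-- fed states -/
local notation "FedBy(" ν ", " f ", " u ")" =>
  (Torus.eGradNormSq (((u : H3) : L2) : Vec3) ≠ ⊤ ∧
    ν * ENNReal.toReal (Torus.eGradNormSq (((u : H3) : L2) : Vec3)) ≤ Torus.pairing ((u : H3) : L2) f)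

-- the shell identification `hset` is adapted from
-- Literature/Analysis/FluidPDE/StatisticalSolutionEnergyEq.lean (`IsStationaryStatisticalSolution.ae_norm_le`)
/-- **Starved states ride on fed ones, shell by shell.**  For `ν > 0`, a smooth force `f`, a
stationary statistical solution `μ` of `NS_ν(f)` on `T³` and `a > 0`: if `μ` charges no FED state
(`‖∇u‖² < ∞` and `ν‖∇u‖² ≤ (u, f)`) of the shell `{a ≤ |u|}`, then `μ {a ≤ |u|} = 0`.  Uses only
finite mean enstrophy (1.29) and the shell energy inequality (1.31) of FMRT Ch. IV Def. 1.3. -/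
theorem stub_starvedRide :
    ∀ ν : ℝ, 0 < ν → ∀ f : Vec3, Torus.IsSmooth f →
      ∀ μ : Measure H3, Torus.IsStationaryStatisticalSolution ν f μ →
        ∀ a : ℝ, 0 < a → μ {u : H3 | a ≤ ‖u‖ ∧ FedBy(ν, f, u)} = 0 → μ {u : H3 | a ≤ ‖u‖} = 0 := by
  intro ν _hν f hfs μ hμ a ha0 hfed
  haveI := hμ.prob
  have hf : MemLp f 2 volume := hfs.memLp 2
  -- the integrand of the energy inequality and its integrability
  set I : H3 → ℝ := fun u =>
    ν * (Torus.eGradNormSq (((u : H3) : L2) : Vec3)).toReal - Torus.pairing ((u : H3) : L2) f with hI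
  have hIint : Integrable I μ :=
    (hμ.integrable_toReal_eGradNormSq.const_mul ν).sub (hμ.integrable_pairing hf)
  set S : Set H3 := {u | a ≤ ‖u‖} with hS
  have hSm : MeasurableSet S := measurableSet_le measurable_const continuous_norm.measurable
  -- the energy inequality (1.31) on the shell `[a², ∞)`
  have hineq := hμ.energy_ineq ((ENNReal.ofReal a) ^ 2) ⊤ (by simp)
  have hset : {u : H3 | ENNReal.ofReal a ^ 2 ≤ ‖u‖ₑ ^ 2 ∧ ‖u‖ₑ ^ 2 < ⊤} = S := by
    ext u
    simp only [Set.mem_setOf_eq, hS]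
    constructor
    · rintro ⟨h1, -⟩
      by_contra hlt
      rw [not_le] at hlt
      have : ‖u‖ₑ ^ 2 < ENNReal.ofReal a ^ 2 := by
        rw [← ofReal_norm]
        exact (ENNReal.pow_lt_pow_left_iff two_ne_zero).2
          ((ENNReal.ofReal_lt_ofReal_iff ha0).2 hlt)
      exact absurd h1 (not_le.2 this)
    · intro h
      refine ⟨?_, ENNReal.pow_lt_top enorm_lt_top⟩
      rw [← ofReal_norm]
      exact pow_le_pow_left' (ENNReal.ofReal_le_ofReal h) 2
  rw [hset] at hineq
  change ∫ u in S, I u ∂μ ≤ 0 at hineq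
  -- `μ`-a.e. state of the shell is starved with finite enstrophy: the integrand is positive there
  have hnfed : ∀ᵐ u ∂μ, u ∉ {u : H3 | a ≤ ‖u‖ ∧ FedBy(ν, f, u)} :=
    measure_eq_zero_iff_ae_notMem.1 hfed
  have hpos : ∀ᵐ u ∂μ, u ∈ S → 0 < I u := by
    filter_upwards [hμ.ae_eGradNormSq_lt_top, hnfed] with u hu hun huS
    have hua : a ≤ ‖u‖ := huS
    simp only [not_and, not_le] at hun
    have hlt := hun hua hu.ne
    rw [hI]
    dsimp only
    linarith
  have hposS : ∀ᵐ u ∂(μ.restrict S), 0 < I u := by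
    filter_upwards [ae_restrict_of_ae hpos, ae_restrict_mem hSm] with u hu huS using hu huS
  have hnonneg : 0 ≤ᵐ[μ.restrict S] I := hposS.mono fun u hu => hu.le
  -- so the shell integral vanishes, the integrand is a.e. zero on the shell: the shell is null
  have hint0 : ∫ u in S, I u ∂μ = 0 := le_antisymm hineq (integral_nonneg_of_ae hnonneg)
  have hae0 : I =ᵐ[μ.restrict S] 0 :=
    (integral_eq_zero_iff_of_nonneg_ae hnonneg hIint.integrableOn).1 hint0
  have hfalse : ∀ᵐ u ∂(μ.restrict S), False := by
    filter_upwards [hposS, hae0] with u hu hu0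
    have h0 : I u = 0 := by simpa only [Pi.zero_apply] using hu0
    exact hu.ne' h0
  have hnmem : ∀ᵐ u ∂μ, u ∉ S := by
    filter_upwards [(ae_restrict_iff' hSm).1 hfalse] with u hu huS using hu huS
  exact measure_eq_zero_iff_ae_notMem.2 hnmem

end Summit.AnomalousDissipation.AnomalousDissipation.Theorems.TaylorCertificatesEnsembleCeiling

end
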